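import Literature.Probability.RandomPlanarGeometry.HexSAWStripThresholdLinearLower
import HarnessLib

/-!
# The bridge series of the strip diverges AT LEAST to first order at its radius: `B_T(x_c; y) ≥ a_T/(y_T − y) − C_T` on `[0, y_T)`
# (BBdGDCG 2014, Corollary 8: "the series (in `y`) `A_T(x_c,y)`, `B_T(x_c,y)` and `C_T(x_c,y)` have radius of convergence `y_T`")

Topic `Literature/Probability/RandomPlanarGeometry` (continues `HexSAWStripThresholdLinearLower.lean` — the lower linear law in coefficient form,
`HV.partialSum_stripBcoeff_stripYT_ge_linear : s·M − C ≤ Σ_{m ≤ M} β_{T,m} y_T^m` — and `HexSAWStripSurfaceRadius.lean` /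
`HexSAWStripSurfaceThresholdRate.lean` — `B_T(x_c; y) = Σ_m β_{T,m} y^m` for `0 ≤ y < y_T`, `B_T(x_c; y) → +∞` as `y ↑ y_T`).  Source:
N. R. Beaton, M. Bousquet-Mélou, J. de Gier, H. Duminil-Copin, A. J. Guttmann, *The critical fugacity for surface adsorption of self-avoiding
walks on the honeycomb lattice is `1 + √2`*, CMP 326 (2014), arXiv:1109.0358v5, §3.2 Corollary 8 (p. 12): "The series (in `y`) `A_T(x_c, y)`,
`B_T(x_c, y)` and `C_T(x_c, y)` have radius of convergence `y_T`".  Print gives the radius (and, via the transfer matrix, rationality — not used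
here; a rational series with nonnegative coefficients has a pole at its radius, so a lower bound of this shape is implicit there; the order of the
pole is not printed); the RATE of divergence at the radius is not printed as such.  The tree has the qualitative divergence `HV.tendsto_stripByLim_nhdsLT_stripYT`; this
file makes it quantitative from below by an Abelian step on the lower linear coefficient law.

## What is proved (namespace `Literature.Probability.RandomPlanarGeometry.SAW.HV`; `x_c = hexCriticalFugacity`, `y_T = HV.stripYT T`, every `T ≥ 1`)

* `HypLow.pow_mul_partialSum_stripBcoeff_le` — the Abelian comparison `r^M · Σ_{m ≤ M} β_{T,m} y^m ≤ Σ_{m ≤ M} β_{T,m} (r y)^m` (`0 ≤ r ≤ 1`, `0 ≤ y`).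
* `HypLow.half_le_one_sub_pow_floor` — `1/2 ≤ (1 − t)^⌊1/(2t)⌋₊` for `0 < t ≤ 1` (Bernoulli).
* ★★ `exists_div_sub_le_stripByLim` — THE LOWER HYPERBOLIC LAW: `∃ a > 0, ∃ C, ∀ y ∈ [0, y_T), a/(y_T − y) − C ≤ B_T(x_c; y)`.
* ★ `eventually_le_stripByLim_mul_sub` — `∃ a > 0`, eventually as `y ↑ y_T`: `a ≤ B_T(x_c; y) · (y_T − y)`; and
  `frequently`-free corollary `exists_Ico_le_stripByLim_mul_sub` — the same on a whole left neighbourhood `[y₀, y_T)`.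

Label: lane COROLLARY (S) of the lower linear coefficient law (tree, a-p2 g17) by the Abelian step `M ≈ y_T/(2(y_T − y))`; lane «pcv-sawmu»,
a-p2 g17.  Together with the lane's first-order UPPER bound (P) `B_T(x_c; y)(y_T − y) ≤ A_T` (tree: `HexSAWStripBridgeRenewal.lean`,
`HV.stripByLim_mul_sub_le_of_one_le`; not imported here) it pins the divergence of
`B_T(x_c; ·)` at `y_T` to EXACTLY first order, `B_T(x_c; y) ≍ 1/(y_T − y)`, without rationality or Perron–Frobenius.  NOT claimed: the upper
bound, the existence of `lim B_T(x_c; y)(y_T − y)` (a renewal constant), anything at `y ≥ y_T`, uniformity in `T`.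
-/

noncomputable section

open Finset Filter Topology Literature.Probability.LatticeModels Literature.Probability.Percolation

namespace Literature.Probability.RandomPlanarGeometry.SAW.HV

variable {T : ℕ}

namespace HypLow

/-- Abelian comparison of partial sums: for `0 ≤ r ≤ 1`, `0 ≤ y`, `r^M · Σ_{m ≤ M} β_{T,m} y^m ≤ Σ_{m ≤ M} β_{T,m} (r·y)^m` (`T ≥ 1`, so that
`β_{T,m} ≥ 0`). [cite: BeatonBousquetMelouDeGierDuminilCopinGuttmann2014, Corollary 8 (arXiv v5 p. 12); lane plumbing] -/
theorem pow_mul_partialSum_stripBcoeff_le (hT : 1 ≤ T) {r y : ℝ} (hr0 : 0 ≤ r) (hr1 : r ≤ 1) (hy : 0 ≤ y) (M : ℕ) :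
    r ^ M * ∑ m ∈ range (M + 1), stripBcoeff T m * y ^ m ≤ ∑ m ∈ range (M + 1), stripBcoeff T m * (r * y) ^ m := by
  rw [mul_sum]
  refine sum_le_sum fun m hm => ?_
  rw [mem_range] at hm
  have hrm : r ^ M ≤ r ^ m := pow_le_pow_of_le_one hr0 hr1 (by omega)
  rw [mul_pow]
  calc r ^ M * (stripBcoeff T m * y ^ m) ≤ r ^ m * (stripBcoeff T m * y ^ m) :=
        mul_le_mul_of_nonneg_right hrm (mul_nonneg (stripBcoeff_nonneg hT m) (pow_nonneg hy m))
    _ = stripBcoeff T m * (r ^ m * y ^ m) := by ring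

/-- Bernoulli at the Abelian cut-off: for `0 < t ≤ 1` and `M = ⌊1/(2t)⌋₊`, `1/2 ≤ (1 − t)^M` (since `M·t ≤ 1/2`).
[cite: BeatonBousquetMelouDeGierDuminilCopinGuttmann2014, Corollary 8 (arXiv v5 p. 12); lane plumbing] -/
theorem half_le_one_sub_pow_floor {t : ℝ} (ht0 : 0 < t) (ht1 : t ≤ 1) : (1 / 2 : ℝ) ≤ (1 - t) ^ ⌊1 / (2 * t)⌋₊ := by
  have hM : (⌊1 / (2 * t)⌋₊ : ℝ) ≤ 1 / (2 * t) := Nat.floor_le (by positivity)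
  have hMt : (⌊1 / (2 * t)⌋₊ : ℝ) * t ≤ 1 / 2 := by
    calc (⌊1 / (2 * t)⌋₊ : ℝ) * t ≤ 1 / (2 * t) * t := mul_le_mul_of_nonneg_right hM ht0.le
      _ = 1 / 2 := by field_simp
  have hB : 1 + (⌊1 / (2 * t)⌋₊ : ℝ) * (-t) ≤ (1 + (-t)) ^ ⌊1 / (2 * t)⌋₊ := one_add_mul_le_pow (by linarith) _
  rw [← sub_eq_add_neg] at hB
  linarith

end HypLow

open HypLow

/-- ★★ **THE LOWER HYPERBOLIC LAW for the bridge series of the strip, every `T ≥ 1`**: there are `a > 0` and `C` with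
`a/(y_T − y) − C ≤ B_T(x_c; y)` for every `0 ≤ y < y_T`.  Proof: `B_T(x_c; y) ≥ Σ_{m ≤ M} β_{T,m} y^m ≥ (y/y_T)^M (s·M − C)` by the lower linear
coefficient law, with `M = ⌊y_T/(2(y_T − y))⌋` so that `(y/y_T)^M ≥ 1/2`; `a = s·y_T/4`.
[cite: BeatonBousquetMelouDeGierDuminilCopinGuttmann2014, Corollary 8 (arXiv v5 p. 12: "The series (in y) … B_T(x_c, y) … have radius of convergence y_T"); lane «pcv-sawmu»: NEW quantitative rate at the radius, lower half] -/
theorem exists_div_sub_le_stripByLim (hT : 1 ≤ T) :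
    ∃ a : ℝ, 0 < a ∧ ∃ C : ℝ, ∀ y : ℝ, 0 ≤ y → y < stripYT T → a / (stripYT T - y) - C ≤ stripByLim T y := by
  obtain ⟨s, hs, C, hsC⟩ := partialSum_stripBcoeff_stripYT_ge_linear hT
  have hYT : 0 < stripYT T := stripYT_pos hT
  refine ⟨s * stripYT T / 4, by positivity, (s + C) / 2, fun y hy0 hyT => ?_⟩
  -- the Abelian parameters
  set t : ℝ := (stripYT T - y) / stripYT T with ht_def
  have ht0 : 0 < t := div_pos (sub_pos.2 hyT) hYT
  have ht1 : t ≤ 1 := by rw [ht_def, div_le_one hYT]; linarith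
  have hr : 1 - t = y / stripYT T := by rw [ht_def]; field_simp; ring
  set M : ℕ := ⌊1 / (2 * t)⌋₊ with hM_def
  have hMlo : 1 / (2 * t) - 1 ≤ (M : ℝ) := by
    have := Nat.lt_floor_add_one (1 / (2 * t)); rw [← hM_def] at this; linarith
  have hhalf : (1 / 2 : ℝ) ≤ (1 - t) ^ M := half_le_one_sub_pow_floor ht0 ht1
  -- B_T(y) ≥ partial sum ≥ (1 - t)^M · partial sum at y_T
  have hpart : ∑ m ∈ range (M + 1), stripBcoeff T m * y ^ m ≤ stripByLim T y :=
    sum_le_hasSum _ (fun m _ => mul_nonneg (stripBcoeff_nonneg hT m) (pow_nonneg hy0 m)) (hasSum_stripBcoeff_of_lt_stripYT hT hy0 hyT)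
  have hab : (1 - t) ^ M * ∑ m ∈ range (M + 1), stripBcoeff T m * stripYT T ^ m ≤ ∑ m ∈ range (M + 1), stripBcoeff T m * y ^ m := by
    have h := pow_mul_partialSum_stripBcoeff_le hT (r := 1 - t) (by linarith) (by linarith) hYT.le M
    have hry : (1 - t) * stripYT T = y := by rw [hr]; field_simp
    rw [hry] at h
    exact h
  have hlin : s * (M : ℝ) - C ≤ ∑ m ∈ range (M + 1), stripBcoeff T m * stripYT T ^ m := hsC M
  have hPnn : 0 ≤ ∑ m ∈ range (M + 1), stripBcoeff T m * stripYT T ^ m :=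
    sum_nonneg fun m _ => mul_nonneg (stripBcoeff_nonneg hT m) (pow_nonneg hYT.le m)
  have hpow1 : (1 - t) ^ M ≤ 1 := pow_le_one₀ (by linarith) (by linarith)
  -- (1-t)^M · P ≥ (1/2) · (sM - C), whether or not sM - C ≥ 0
  have hkey : (1 / 2 : ℝ) * (s * (M : ℝ) - C) ≤ (1 - t) ^ M * ∑ m ∈ range (M + 1), stripBcoeff T m * stripYT T ^ m := by
    rcases le_or_gt 0 (s * (M : ℝ) - C) with h | h
    · calc (1 / 2 : ℝ) * (s * (M : ℝ) - C) ≤ (1 - t) ^ M * (s * (M : ℝ) - C) := mul_le_mul_of_nonneg_right hhalf h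
        _ ≤ _ := mul_le_mul_of_nonneg_left hlin (by linarith)
    · have : (1 / 2 : ℝ) * (s * (M : ℝ) - C) ≤ 0 := by nlinarith
      exact this.trans (mul_nonneg (by linarith) hPnn)
  -- the hyperbola: s·M/2 ≥ s/(4t) - s/2 = (s y_T/4)/(y_T - y) - s/2
  have hhyp : s * stripYT T / 4 / (stripYT T - y) = s / 4 * (1 / t) := by
    rw [ht_def]; field_simp
  have h1t : 1 / t ≤ 2 * ((M : ℝ) + 1) := by
    have : 1 / (2 * t) = (1 / t) / 2 := by rw [div_div, mul_comm]
    rw [this] at hMlo; linarith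
  rw [hhyp]
  nlinarith [hkey.trans (hab.trans hpart), hs.le, h1t]

/-- ★ **`B_T(x_c; y)·(y_T − y)` is bounded away from `0` as `y ↑ y_T`** (`T ≥ 1`): there are `a > 0` and `y₀ < y_T` with
`a ≤ B_T(x_c; y)(y_T − y)` for all `y ∈ [y₀, y_T)`. [cite: BeatonBousquetMelouDeGierDuminilCopinGuttmann2014, Corollary 8 (arXiv v5 p. 12); lane «pcv-sawmu»: lower half of the first-order rate] -/
theorem exists_Ico_le_stripByLim_mul_sub (hT : 1 ≤ T) :
    ∃ a : ℝ, 0 < a ∧ ∃ y₀ : ℝ, y₀ < stripYT T ∧ ∀ y ∈ Set.Ico y₀ (stripYT T), a ≤ stripByLim T y * (stripYT T - y) := by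
  obtain ⟨a, ha, C, hC⟩ := exists_div_sub_le_stripByLim hT
  have hYT : 0 < stripYT T := stripYT_pos hT
  -- on [y₀, y_T) with y₀ ≥ 0 and C (y_T - y) ≤ a/2
  set δ : ℝ := min (stripYT T) (a / (2 * (|C| + 1))) with hδ_def
  have hδ0 : 0 < δ := lt_min hYT (by positivity)
  refine ⟨a / 2, by positivity, stripYT T - δ, by linarith, fun y hy => ?_⟩
  obtain ⟨hy1, hy2⟩ := hy
  have hd0 : 0 < stripYT T - y := sub_pos.2 hy2
  have hdδ : stripYT T - y ≤ δ := by linarith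
  have hy0 : 0 ≤ y := by have := min_le_left (stripYT T) (a / (2 * (|C| + 1))); linarith
  have h := hC y hy0 hy2
  -- multiply through by (y_T - y) > 0
  have h' : a - C * (stripYT T - y) ≤ stripByLim T y * (stripYT T - y) := by
    have := mul_le_mul_of_nonneg_right h hd0.le
    rwa [sub_mul, div_mul_cancel₀ _ hd0.ne'] at this
  have hCd : C * (stripYT T - y) ≤ a / 2 := by
    calc C * (stripYT T - y) ≤ |C| * (stripYT T - y) := mul_le_mul_of_nonneg_right (le_abs_self C) hd0.le
      _ ≤ (|C| + 1) * δ := by nlinarith [abs_nonneg C]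
      _ ≤ (|C| + 1) * (a / (2 * (|C| + 1))) := mul_le_mul_of_nonneg_left (min_le_right _ _) (by positivity)
      _ = a / 2 := by field_simp
  linarith

/-- ★ Filter form: `∃ a > 0, ∀ᶠ y in 𝓝[<] y_T, a ≤ B_T(x_c; y)·(y_T − y)` (`T ≥ 1`).
[cite: BeatonBousquetMelouDeGierDuminilCopinGuttmann2014, Corollary 8 (arXiv v5 p. 12); lane «pcv-sawmu»: lower half of the first-order rate] -/
theorem eventually_le_stripByLim_mul_sub (hT : 1 ≤ T) :
    ∃ a : ℝ, 0 < a ∧ ∀ᶠ y in 𝓝[<] stripYT T, a ≤ stripByLim T y * (stripYT T - y) := by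
  obtain ⟨a, ha, y₀, hy₀, h⟩ := exists_Ico_le_stripByLim_mul_sub hT
  exact ⟨a, ha, mem_of_superset (Ico_mem_nhdsLT hy₀) h⟩

/-- ★ Divergence with a rate, restated: `B_T(x_c; y) ≥ a/(y_T − y) − C` forces `(y_T − y)·B_T(x_c; y) ↛ 0`; in particular the tree's
`tendsto_stripByLim_nhdsLT_stripYT` (`B_T → +∞`) is recovered quantitatively: `B_T(x_c; y) ≥ a/(2(y_T − y))` on a left neighbourhood of `y_T`.
[cite: BeatonBousquetMelouDeGierDuminilCopinGuttmann2014, Corollary 8 (arXiv v5 p. 12); lane «pcv-sawmu»] -/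
theorem eventually_div_le_stripByLim (hT : 1 ≤ T) :
    ∃ a : ℝ, 0 < a ∧ ∀ᶠ y in 𝓝[<] stripYT T, a / (stripYT T - y) ≤ stripByLim T y := by
  obtain ⟨a, ha, y₀, hy₀, h⟩ := exists_Ico_le_stripByLim_mul_sub hT
  refine ⟨a, ha, mem_of_superset (Ico_mem_nhdsLT hy₀) fun y hy => ?_⟩
  have hd0 : 0 < stripYT T - y := sub_pos.2 hy.2
  show a / (stripYT T - y) ≤ stripByLim T y
  rw [div_le_iff₀ hd0]
  exact h y hy

end Literature.Probability.RandomPlanarGeometry.SAW.HV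

end
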